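import Summits.ResolutionOfSingularities.ResolutionOfSingularities.Theorems.HomologicalConductorNoZenoBirthDefs
import Summits.ResolutionOfSingularities.ResolutionOfSingularities.Theorems.HomologicalConductorNoZenoNoetherianCase
import Summits.ResolutionOfSingularities.ResolutionOfSingularities.Theorems.HomologicalConductorNoZenoIffKernel
import Summits.ResolutionOfSingularities.ResolutionOfSingularities.Theorems.HomologicalConductorSurfaceTerminationRegimes
import Summits.ResolutionOfSingularities.ResolutionOfSingularities.Theorems.SyzygyFlatteningHigherRankTerminationLocAt
import Literature.AlgebraicGeometry.Resolution.InseparableLocalUniformization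
import HarnessLib

/-!
# Route `HomologicalConductor`, support `SurfaceTermination` (stmt-ResolutionOfSingularities-16488): the residual criterion

For a two-dimensional function field `K/k` (`tr.deg_k K ≤ 2`) and the canonical normalised
`ca`-tower `T_m = tower O A m` (`Theorems/HomologicalConductorNoZenoBirthDefs.lean`) along a
valuation ring `O ⊇ k ∪ A`:

* `exists_regular_of_residually_transcendental_mem_tower` — **if some stage `T_m` contains an
  element `t` whose residue in `κ(O)` is transcendental over `k`** (no non-zero `f ∈ k[X]` has
  `v(f(t)) > 0`), **then `T_m` or `T_(m+1)` is regular.** Indeed every non-zero `f(t)` is an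
  `O`-unit of `T_m`, so the field `k(t)` lies in `T_m`; then
  `dim T_m ≤ tr.deg_{k(t)} K = tr.deg_k K − 1 ≤ 1` (`dim ≤ tr.deg` over the field `k(t)`, tree
  `ringKrullDim_le_of_trdeg_le`), and a stage of dimension `≤ 1` is regular or is followed by a
  regular one (Krull–Akizuki: `StrictDrop.Birth.DimLEOne.stub_dimLEOne_succ_regular`).
* `forall_not_mem_tower_of_forall_not_regular` — contrapositive: if every stage is singular, no
  stage ever contains a residually transcendental element of `O`. In particular a prime divisor
  (divisorial place) `O` of a surface whose tower never becomes regular is NOT exhausted by the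
  tower (its residue field is transcendental over `k`, those of the 2-dimensional stages are
  algebraic): for divisorial `O`, "the tower terminates", "some stage contains a residually
  transcendental element" and "the stages exhaust `O`" (capture, `exists_regular_of_exhausts`)
  are EQUIVALENT — the typed regime E2 (`SurfaceExhaustion`) of chain W4.4 coincides with K2.

Unconditional (no `Persistence`/`StrictDrop`). References: H. Matsumura, *Commutative Ring
Theory*, Thm. 5.6 (dim ≤ tr.deg) and Thm. 11.7 (Krull–Akizuki) [`Matsumura1987`];
O. Zariski, P. Samuel, *Commutative Algebra* II, VI §14 [`ZariskiSamuel1960`].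
-/

noncomputable section

-- single-problem summit: the doubled namespace component `ResolutionOfSingularities` is forced
set_option linter.dupNamespace false

namespace Summit.ResolutionOfSingularities.ResolutionOfSingularities.Theorems.SurfaceTermination.Regimes

open Summit.ResolutionOfSingularities.ResolutionOfSingularities.Theses.HomologicalConductor
open Summit.ResolutionOfSingularities.ResolutionOfSingularities.Theorems.NoZeno.Birth
open Literature.AlgebraicGeometry.Resolution Polynomial

variable {k K : Type} [Field k] [Field K] [Algebra k K]

/-- **A stage containing the field `k(t)` has dimension `≤ tr.deg_k K − 1`** (here: `tr.deg ≤ 2`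
gives `dim ≤ 1`): `T` is a domain over the field `k(t)` with `tr.deg_{k(t)} T ≤ tr.deg_{k(t)} K`, and
`tr.deg_k k(t) + tr.deg_{k(t)} K = tr.deg_k K` with `tr.deg_k k(t) ≥ 1` for `t` transcendental.
[cite: Matsumura1987, Thm. 5.6] -/
theorem ringKrullDim_le_one_of_adjoin_simple_le (T : Subalgebra k K) (htr : Algebra.trdeg k K ≤ 2)
    {t : K} (ht : Transcendental k t)
    (hFT : ∀ x : K, x ∈ IntermediateField.adjoin k ({t} : Set K) → x ∈ T) :
    ringKrullDim ↥T ≤ 1 := by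
  set F : IntermediateField k K := IntermediateField.adjoin k ({t} : Set K) with hFdef
  -- `T` as an `F`-algebra inside `K`
  let ι : ↥F →+* ↥T :=
    { toFun := fun x => ⟨(x : K), hFT x x.2⟩
      map_one' := rfl
      map_mul' := fun _ _ => rfl
      map_zero' := rfl
      map_add' := fun _ _ => rfl }
  letI : Algebra ↥F ↥T := ι.toAlgebra
  haveI : IsScalarTower ↥F ↥T K := IsScalarTower.of_algebraMap_eq fun _ => rfl
  haveI : FaithfulSMul k ↥F :=
    (faithfulSMul_iff_algebraMap_injective k ↥F).mpr (algebraMap k ↥F).injective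
  haveI : FaithfulSMul ↥F K :=
    (faithfulSMul_iff_algebraMap_injective ↥F K).mpr (algebraMap ↥F K).injective
  -- `tr.deg_F T ≤ tr.deg_F K`
  have h1 : Algebra.trdeg ↥F ↥T ≤ Algebra.trdeg ↥F K :=
    trdeg_le_of_injective (IsScalarTower.toAlgHom ↥F ↥T K)
      (fun a b h => Subtype.ext (by simpa using h))
  -- `1 ≤ tr.deg_k F`
  have ht' : Transcendental k (⟨t, IntermediateField.mem_adjoin_simple_self k t⟩ : ↥F) :=
    fun h => ht (by simpa using h.algebraMap (A := K))
  haveI : Algebra.Transcendental k ↥F := ⟨⟨_, ht'⟩⟩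
  have h2 : 1 ≤ Algebra.trdeg k ↥F := Cardinal.one_le_iff_pos.mpr (trdeg_pos k ↥F)
  -- `tr.deg_k F + tr.deg_F K = tr.deg_k K ≤ 2`
  have h3 : Algebra.trdeg k ↥F + Algebra.trdeg ↥F K ≤ 2 := by
    rw [trdeg_add_eq k ↥F (A := K)]; exact htr
  have h2lt : (2 : Cardinal) < Cardinal.aleph0 := by exact_mod_cast Cardinal.natCast_lt_aleph0 (n := 2)
  obtain ⟨a, ha⟩ := Cardinal.lt_aleph0.mp ((le_self_add.trans h3).trans_lt h2lt)
  obtain ⟨b, hb⟩ := Cardinal.lt_aleph0.mp ((le_add_self.trans h3).trans_lt h2lt)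
  rw [ha, hb] at h3
  rw [ha] at h2
  rw [hb] at h1
  have h3' : a + b ≤ 2 := by exact_mod_cast h3
  have h2' : 1 ≤ a := by exact_mod_cast h2
  have hb1 : b ≤ 1 := by omega
  have hT : Algebra.trdeg ↥F ↥T ≤ (1 : ℕ) := h1.trans (by exact_mod_cast hb1)
  exact ringKrullDim_le_of_trdeg_le hT

/-- **The residual criterion.** In transcendence degree `≤ 2`: if some stage `T_m` of the tower
along `O` contains an element `t` whose residue in `κ(O)` is transcendental over `k`
(`∀ f ≠ 0, v(f(t)) = 0`), then the tower reaches a regular local ring at `m` or `m + 1`. Every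
non-zero `f(t)` is an `O`-unit of `T_m`, hence inverted in `T_m = loc O T_m`, so `k(t) ⊆ T_m` and
`dim T_m ≤ 1` (`ringKrullDim_le_one_of_adjoin_simple_le`); conclude by the Krull–Akizuki step
`StrictDrop.Birth.DimLEOne.stub_dimLEOne_succ_regular`. Unconditional. [cite: Matsumura1987, Thm. 11.7] -/
theorem exists_regular_of_residually_transcendental_mem_tower (p : ℕ) (hp : p.Prime)
    (k K : Type) [Field k] [CharP k p] [Field K] [Algebra k K] (O : ValuationSubring K)
    (A : Subalgebra k K) (hk : ∀ c : k, algebraMap k K c ∈ O) (hA : A.FG)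
    (hfr : IsFractionRing ↥A K) (hAO : A.toSubring ≤ O.toSubring) (htr : Algebra.trdeg k K ≤ 2)
    {t : K} (hval : ∀ f : k[X], f ≠ 0 → ¬ O.valuation (aeval t f) < 1) (m : ℕ)
    (htm : t ∈ tower O A m) :
    ∃ m' : ℕ, IsRegularLocalRing ↥(tower O A m') := by
  have hTO : (tower O A m).toSubring ≤ O.toSubring :=
    fun x hx => mem_valuationSubring_of_mem_tower O hk hAO m x hx
  -- `O`-units of the stage are inverted in the stage (`T_m = loc O B`)
  have hinv : ∀ {s : K}, s ∈ tower O A m → s⁻¹ ∈ O → s⁻¹ ∈ tower O A m := by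
    intro s hs hsO
    by_cases hs0 : s = 0
    · rw [hs0, inv_zero]; exact (tower O A m).zero_mem
    obtain ⟨B, hBO, hTB⟩ := exists_tower_eq_loc O A hk hAO m
    have hsO' : s ∈ O := hTO hs
    rw [hTB, loc_eq_locAt] at hs ⊢
    exact SyzygyFlattening.inv_mem_locAt O B hBO hs
      (SyzygyFlattening.valuation_eq_one_of_inv_mem O hsO' hsO hs0)
  -- `t` is transcendental over `k`
  have ht : Transcendental k t := by
    rintro ⟨f, hf0, hf⟩
    exact hval f hf0 (by rw [hf, map_zero]; exact zero_lt_one)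
  -- `k[t] ⊆ T_m`, and every non-zero `f(t)` is inverted in `T_m`
  have hadj : Algebra.adjoin k ({t} : Set K) ≤ tower O A m :=
    Algebra.adjoin_le (Set.singleton_subset_iff.mpr htm)
  have hpoly : ∀ f : k[X], aeval t f ∈ tower O A m := fun f =>
    hadj (by rw [Algebra.adjoin_singleton_eq_range_aeval]; exact ⟨f, rfl⟩)
  have hunit : ∀ f : k[X], f ≠ 0 → (aeval t f)⁻¹ ∈ tower O A m := by
    intro f hf0
    refine hinv (hpoly f) ?_
    have hle : O.valuation (aeval t f) ≤ 1 := (O.valuation_le_one_iff _).mpr (hTO (hpoly f))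
    have heq : O.valuation (aeval t f) = 1 := le_antisymm hle (not_lt.mp (hval f hf0))
    rw [← O.valuation_le_one_iff, map_inv₀, heq, inv_one]
  -- hence `k(t) ⊆ T_m`
  have hFT : ∀ x : K, x ∈ IntermediateField.adjoin k ({t} : Set K) → x ∈ tower O A m := by
    intro x hx
    obtain ⟨r, s, rfl⟩ := (IntermediateField.mem_adjoin_simple_iff k x).mp hx
    by_cases hs : s = 0
    · rw [hs, map_zero, div_zero]; exact (tower O A m).zero_mem
    · rw [div_eq_mul_inv]
      exact (tower O A m).mul_mem (hpoly r) (hunit s hs)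
  -- `dim T_m ≤ 1`, then Krull–Akizuki
  have hdim : ringKrullDim ↥(tower O A m) ≤ 1 :=
    ringKrullDim_le_one_of_adjoin_simple_le (tower O A m) htr ht hFT
  have hshape := StrictDrop.Birth.TowerShape.stub_towerShape p hp k K O A hk hA hfr hAO
  by_cases hreg : IsRegularLocalRing ↥(tower O A m)
  · exact ⟨m, hreg⟩
  · exact ⟨m + 1, StrictDrop.Birth.DimLEOne.stub_dimLEOne_succ_regular p hp k K O A hk hA hfr hAO
      hshape m hdim hreg⟩

/-- **Contrapositive: a never-regular tower never picks up a residually transcendental element.**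
If every stage of the tower along `O` (`tr.deg_k K ≤ 2`) is singular, then an element `t ∈ K`
with residue transcendental over `k` lies in no stage. For a prime divisor `O` of a surface this
says: the stages exhaust `O` only if the tower terminates (the residue field of `O` is
transcendental over `k`); so the regime "exhaustion along divisorial places" is the divisorial
termination statement itself, not a weaker lever. [cite: ZariskiSamuel1960, Ch. VI §14] -/
theorem forall_not_mem_tower_of_forall_not_regular (p : ℕ) (hp : p.Prime)
    (k K : Type) [Field k] [CharP k p] [Field K] [Algebra k K] (O : ValuationSubring K)
    (A : Subalgebra k K) (hk : ∀ c : k, algebraMap k K c ∈ O) (hA : A.FG)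
    (hfr : IsFractionRing ↥A K) (hAO : A.toSubring ≤ O.toSubring) (htr : Algebra.trdeg k K ≤ 2)
    (hsing : ∀ m : ℕ, ¬ IsRegularLocalRing ↥(tower O A m))
    {t : K} (hval : ∀ f : k[X], f ≠ 0 → ¬ O.valuation (aeval t f) < 1) (m : ℕ) :
    t ∉ tower O A m := fun htm => by
  obtain ⟨m', hm'⟩ := exists_regular_of_residually_transcendental_mem_tower p hp k K O A hk hA hfr
    hAO htr hval m htm
  exact hsing m' hm'

end Summit.ResolutionOfSingularities.ResolutionOfSingularities.Theorems.SurfaceTermination.Regimes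

end
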